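import Summits.QuantumFields.YangMills.Theorems.LuscherReductionTwistedTraceScalingZPEContinuous
import Summits.QuantumFields.YangMills.Theorems.LuscherReductionOneSiteLevelsIMS
import HarnessLib

/-!
# The Riccati trial state is PHYSICAL: `stiffTrial g` is gauge and twist invariant, hence `IsPhys` for continuous `g ≥ 0`
# (lane A of S-BASE, crux `TwistedTraceScaling` stmt-QuantumFields-20203; a brick for the k = 0 FLOOR of the BO sub-target — the Rayleigh door
# `mul_le_levelValue_zero_of_subsolution_on` wants a PHYSICAL trial function; design note `pub/ym-fleet/ym-luscher-20007-p1/COARSE-DESIGN.md` §17.8)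

* `plaqCurv_gaugeTransform_eq` — `F(U^h) = R'_h F(U)`; `Frame.IsDiag.adjoint_apply` — a diagonalising frame is an eigenframe of `D†D`;
* ★ `weightForm_gaugeTransform` — the trial exponent `q_{D_U}(F_U)` is gauge invariant (eigenframes transport by `rotFrame`, `inner_rotPlaq`);
* `twist_centreElem_eq_twist3`, `plaqCurv_twist3`, ★ `stiffTrial_gaugeTransform`, ★ `stiffTrial_twist` (every central `z`), `zpeSum_twist`;
* ★★ `isPhys_stiffTrial` — `IsPhys (stiffTrial g)` for `g ≥ 0` continuous on `[0, (10√N)²]`; ★★ `isPhys_stiffTrial_riccati`;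
* `isPhys_indicator_mul_stiffTrial` — `IsPhys (1_B · H)` for a measurable gauge- and twist-invariant `B` (the floor's trial function).
HONEST FRAMING: bookkeeping for a stub lane of a child of the CONDITIONAL reduction route (femto rung R2b1); not infinite volume, not a gap, not Clay.
-/

set_option autoImplicit false

noncomputable section

open MeasureTheory Real Filter Topology
open scoped BigOperators RealInnerProductSpace
open Literature.MathematicalPhysics.QuantumFieldTheory
open Literature.MathematicalPhysics.QuantumLattice

namespace Summit.QuantumFields.YangMills.Theorems.FemtoTransferGap

open TT TwoLattice TwoLattice.Toron TwoLattice.Cov TwoLattice.Stiff TwoLattice.Harm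

variable {L : ℕ} [NeZero L]

/-! ## §1 Gauge invariance of the trial exponent -/

omit [NeZero L] in
/-- `F(U^h) = R'_h F(U)` as vectors of `PlaqSpace`. [cite: Luscher1983, §3] -/
theorem plaqCurv_gaugeTransform_eq (h : Site 3 L → SU2) (U : GaugeConfig 3 L SU2) : plaqCurv (gaugeTransform h U) = rotPlaq h (plaqCurv U) := by
  ext ⟨p, a⟩
  rw [plaqCurv_gaugeTransform, rotPlaq_apply]
  rfl

/-- A diagonalising frame is an eigenframe of `D†D`: `D†(D eᵢ) = aᵢ eᵢ`. [cite: HornJohnson2013, Thm 2.5.6] -/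
theorem Frame.IsDiag.adjoint_apply {ι : Type*} [Fintype ι] [DecidableEq ι] {E F : Type*} [NormedAddCommGroup E] [InnerProductSpace ℝ E]
    [NormedAddCommGroup F] [InnerProductSpace ℝ F] [FiniteDimensional ℝ E] [FiniteDimensional ℝ F] {D : E →ₗ[ℝ] F} {e : OrthonormalBasis ι ℝ E}
    {a : ι → ℝ} (h : Frame.IsDiag D e a) (i : ι) : D.adjoint (D (e i)) = a i • e i := by
  rw [← e.sum_repr' (D.adjoint (D (e i)))]
  have hj : ∀ j, ⟪e j, D.adjoint (D (e i))⟫ = if j = i then a i else 0 := fun j => by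
    rw [LinearMap.adjoint_inner_right, h j i]
    split_ifs with hji
    · subst hji; simp
    · simp
  simp only [hj, ite_smul, zero_smul, Finset.sum_ite_eq', Finset.mem_univ, if_true]

/-- ★ **The trial exponent is gauge invariant**: `q_{D_{U^h}}(F(U^h)) = q_{D_U}(F(U))`. [cite: Luscher1983, §3] -/
theorem weightForm_gaugeTransform (g : ℝ → ℝ) (h : Site 3 L → SU2) (U : GaugeConfig 3 L SU2) :
    weightForm g (covCurl (gaugeTransform h U)) (plaqCurv (gaugeTransform h U)) = weightForm g (covCurl U) (plaqCurv U) := by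
  classical
  have hd : Frame.IsDiag (covCurl U) (gramMatrix_isHermitian (covCurl U)).eigenvectorBasis
      (fun i => (gramMatrix_isHermitian (covCurl U)).eigenvalues i) := Frame.isDiag_gramEigenvectorBasis (covCurl U)
  have hd' := hd.rotate L h
  rw [weightForm_eq_sum g (covCurl U) (fun i => Frame.IsDiag.adjoint_apply hd i) (plaqCurv U),
    weightForm_eq_sum g (covCurl (gaugeTransform h U)) (fun i => Frame.IsDiag.adjoint_apply hd' i) (plaqCurv (gaugeTransform h U))]
  refine Finset.sum_congr rfl fun i _ => ?_
  rw [rotFrame_apply, covCurl_gaugeTransform_eq, plaqCurv_gaugeTransform_eq, inner_rotPlaq]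

/-- ★ **The trial state is gauge invariant.** [cite: Luscher1983, §3] -/
theorem stiffTrial_gaugeTransform (g : ℝ → ℝ) (h : Site 3 L → SU2) (U : GaugeConfig 3 L SU2) :
    stiffTrial g (gaugeTransform h U) = stiffTrial g U := by
  unfold stiffTrial; rw [weightForm_gaugeTransform]

/-! ## §2 Twist invariance -/

omit [NeZero L] in
/-- A single centre twist is a composite twist: `twist k (centreElem b) = twist3 (k ↦ b, else false)`. [cite: tHooft1979] -/
theorem twist_centreElem_eq_twist3 (k : Fin 3) (b : Bool) (U : GaugeConfig 3 L SU2) :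
    twist k (centreElem b) U = TT.twist3 (fun j => decide (j = k) && b) U := by
  have h1 : centreElem false = (1 : SU2) := by simp [centreElem]
  fin_cases k <;> simp [TT.twist3, h1]

omit [NeZero L] in
/-- `F(τ_z U) = F(U)`. [cite: tHooft1979] -/
theorem plaqCurv_twist3 (z : Fin 3 → Bool) (U : GaugeConfig 3 L SU2) : plaqCurv (TT.twist3 z U) = plaqCurv U := by
  ext ⟨p, a⟩
  rw [plaqCurv_apply, plaqCurv_apply, hol_twist3]

/-- The trial state is invariant under composite twists. [cite: tHooft1979] -/
theorem stiffTrial_twist3 (g : ℝ → ℝ) (z : Fin 3 → Bool) (U : GaugeConfig 3 L SU2) : stiffTrial g (TT.twist3 z U) = stiffTrial g U := by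
  unfold stiffTrial; rw [covCurl_twist3, plaqCurv_twist3]

/-- ★ **The trial state is twist invariant** (every central `z`). [cite: tHooft1979] -/
theorem stiffTrial_twist (g : ℝ → ℝ) (k : Fin 3) {z : SU2} (hz : z ∈ Subgroup.center SU2) (U : GaugeConfig 3 L SU2) :
    stiffTrial g (twist k z U) = stiffTrial g U := by
  obtain ⟨b, rfl⟩ := exists_eq_centreElem_of_mem_center hz
  rw [twist_centreElem_eq_twist3, stiffTrial_twist3]

/-- `zpeSum` is twist invariant (every central `z`). [cite: tHooft1979] -/
theorem zpeSum_twist (κ : ℝ) (k : Fin 3) {z : SU2} (hz : z ∈ Subgroup.center SU2) (U : GaugeConfig 3 L SU2) :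
    zpeSum L κ (twist k z U) = zpeSum L κ U := by
  obtain ⟨b, rfl⟩ := exists_eq_centreElem_of_mem_center hz
  rw [twist_centreElem_eq_twist3, zpeSum_twist3]

/-! ## §3 ★★ The trial state is PHYSICAL -/

/-- ★★ **`IsPhys (stiffTrial g)`** for `g ≥ 0` continuous on `[0, (10√N)²]`. [cite: Luscher1983, §3] -/
theorem isPhys_stiffTrial {g : ℝ → ℝ} (hg0 : ∀ s, 0 ≤ g s) (hg : ContinuousOn g (Set.Icc 0 ((10 * Real.sqrt (Fintype.card (Plaquette 3 L × Fin 3))) ^ 2))) :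
    IsPhys (stiffTrial (L := L) g) where
  measurable := measurable_stiffTrial hg
  bounded := ⟨1, fun U => by rw [abs_of_pos (stiffTrial_pos g U)]; exact stiffTrial_le_one hg0 U⟩
  gaugeInv := fun h U => stiffTrial_gaugeTransform g h U
  zeroFlux := fun k z hz U => stiffTrial_twist g k hz U

/-- ★★ **The Riccati trial state is physical** (`μ > 0`, `t, b ≥ 0`… only `μ > 0` is needed for `g ≥ 0`). [cite: Luscher1983, §3] [cite: Wipf2021, §8.5.1] -/
theorem isPhys_stiffTrial_riccati (t b : ℝ) {μ : ℝ} (hμ : 0 < μ) : IsPhys (stiffTrial (L := L) (riccatiWeight t b μ)) :=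
  isPhys_stiffTrial (fun s => riccatiWeight_nonneg hμ s) (continuous_riccatiWeight t b hμ).continuousOn

/-- The floor's trial function `1_B · H` is physical for a measurable gauge- and twist-invariant `B`. [cite: Luscher1983, §3] -/
theorem isPhys_indicator_mul_stiffTrial {g : ℝ → ℝ} (hg0 : ∀ s, 0 ≤ g s)
    (hg : ContinuousOn g (Set.Icc 0 ((10 * Real.sqrt (Fintype.card (Plaquette 3 L × Fin 3))) ^ 2))) {B : Set (GaugeConfig 3 L SU2)}
    (hB : MeasurableSet B) (hBg : ∀ (h : Site 3 L → SU2) (U : GaugeConfig 3 L SU2), gaugeTransform h U ∈ B ↔ U ∈ B)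
    (hBz : ∀ (k : Fin 3), ∀ z ∈ Subgroup.center SU2, ∀ U : GaugeConfig 3 L SU2, twist k z U ∈ B ↔ U ∈ B) :
    IsPhys (fun U => B.indicator (fun _ => (1 : ℝ)) U * stiffTrial (L := L) g U) := by
  classical
  refine IsPhys.mul_of_invariant (isPhys_stiffTrial hg0 hg) (measurable_const.indicator hB) (CJ := 1) (fun U => ?_) (fun h U => ?_) (fun k z hz U => ?_)
  · by_cases hU : U ∈ B <;> simp [Set.indicator, hU]
  · simp only [Set.indicator, hBg h U]
  · simp only [Set.indicator, hBz k z hz U]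

end Summit.QuantumFields.YangMills.Theorems.FemtoTransferGap

end
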